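import Summits.QuantumFields.YangMills.Theorems.LangevinControlUVOSLegsFromFemtoAndGapStubAssemblyShiftedBound
import HarnessLib

/-!
# Crux `HypercubicLimit` (stmt-QuantumFields-8646), line `conditional-mean-telescoping`: sub-goal `ssb_pointwise`
# (the three zones of the scaled shifted bound, per multi-site)

Support file (`--supports stmt-QuantumFields-8646`, c2 seat): the PER-POINT half of the abstract SCALED a-uniform bound at
shifted evaluation points (`stub_scaledShiftedBound` = `ScaledShiftedBound` of `PencilRigidityHypercubicLimitDefsB.lean`, the
analytic core of the closure's leg (U) `stub_uniformBound`; the summed bound is the sequel file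
`PencilRigidityHypercubicLimitScaledShiftedBound.lean`).  Weights `W` on `n`-tuples of sites (`n ≥ 2`) with a sup bound `Mⁿ` and a separated bound of
Gaussian-domination shape `(B (R₀/R)^P)ⁿ`; `F ∈ ⁰𝒮ₙ` evaluated within `6a` of the scaled sites:
`a⁴ⁿ ‖Σₓ W(x) F(y(x))‖ ≤ Kⁿ (Bⁿ + Mⁿ a^{En}) ‖F‖_{(6+E+P) n}`.  Three zones per multi-site (outer: Schwartz decay beyond
`1/(12a)`; near-diagonal: flat decay of order `En`; separated-inner: the separated bound at `R = min R₀ ⌊(ρ−2)/2⌋₊`,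
flat decay of order `Pn`), in the architecture and on the elementary lemmas of the sibling toolkit
`Theorems/LangevinControlUVOSLegsFromFemtoAndGapStubAssemblyShifted{Weights,Bound}.lean`.
Refs: OsterwalderSchrader1975 §2; GlimmJaffe1987 §6.1.
-/

set_option autoImplicit false

noncomputable section

open scoped SchwartzMap BigOperators
open MeasureTheory Filter Topology
open Literature.MathematicalPhysics.QuantumFieldTheory Literature.MathematicalPhysics.QuantumLattice
open Literature.MathematicalPhysics.AQFT
open Literature.Probability.LatticeModels (box Site)
open Summit.QuantumFields.YangMills.Theorems.OSLegsFromFemtoAndGap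

namespace Summit.QuantumFields.YangMills.Cruxes.HypercubicLimit.ConditionalMeanTelescoping

variable {n : ℕ}

/-! ### The three zones, per multi-site -/

/-- **Outer zone** (`3‖xᵢ‖ > L ≥ a⁻²` for some `i`): `‖y‖ ≥ 1/(12a)`, Schwartz decay of order `(6+E)n` pays `a^{En}`. -/
theorem ssb_outer (F : 𝓢((Fin n → (EuclideanSpace ℝ (Fin 4))), ℂ)) {a : ℝ} (ha : 0 < a) (ha24 : a ≤ 1 / 24) {L : ℕ}
    (hL : a⁻¹ * a⁻¹ ≤ L) (x : Fin n → Site 4) {i : Fin n} (hi : (L : ℝ) < 3 * ‖x i‖) (y : Fin n → (EuclideanSpace ℝ (Fin 4)))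
    (hyx : ∀ l, ‖y l - a • siteToE (x l)‖ ≤ 6 * a) {W M : ℝ} (hM : 0 ≤ M) (hW : |W| ≤ M ^ n) (E : ℕ) :
    |W| * ‖F y‖ * (1 + ‖y‖) ^ (6 * n) ≤
      M ^ n * (3 / 2) ^ (6 * n) * 12 ^ (E * n) * a ^ (E * n) * SchwartzMap.seminorm ℂ ((6 + E) * n) 0 F := by
  set t := ‖y‖ with ht
  have hyi : a * ‖x i‖ - 6 * a ≤ ‖y i‖ := norm_ge_of_shift ha.le hyx i
  have hainv : (24 : ℝ) ≤ a⁻¹ := by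
    rw [le_inv_comm₀ (by norm_num) ha]; linarith
  have hLa : a⁻¹ ≤ (L : ℝ) * a := by
    have := mul_le_mul_of_nonneg_right hL ha.le
    rwa [mul_assoc, inv_mul_cancel₀ ha.ne', mul_one] at this
  have ht1 : a⁻¹ / 12 ≤ t := by
    have h1 : (L : ℝ) * a < 3 * (a * ‖x i‖) := by nlinarith
    have h3 : ‖y i‖ ≤ t := norm_le_pi_norm y i
    nlinarith
  have ht2 : (2 : ℝ) ≤ t := by linarith
  have htpos : 0 < t := by linarith
  set S := SchwartzMap.seminorm ℂ ((6 + E) * n) 0 F with hS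
  have hdecay : t ^ ((6 + E) * n) * ‖F y‖ ≤ S := pow_mul_norm_le_seminorm F ((6 + E) * n) y
  have h1t : (1 + t) ^ (6 * n) ≤ (3 / 2 : ℝ) ^ (6 * n) * t ^ (6 * n) := by
    rw [← mul_pow]; exact pow_le_pow_left₀ (by positivity) (by linarith) _
  have h2t : (1 : ℝ) ≤ (12 * a) ^ (E * n) * t ^ (E * n) := by
    rw [← mul_pow]
    refine one_le_pow₀ ?_
    have : a⁻¹ * a = 1 := inv_mul_cancel₀ ha.ne'
    nlinarith
  have hWn : 0 ≤ |W| := abs_nonneg _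
  have hsplit : t ^ ((6 + E) * n) = t ^ (6 * n) * t ^ (E * n) := by
    rw [← pow_add]; congr 1; ring
  calc |W| * ‖F y‖ * (1 + t) ^ (6 * n)
      ≤ M ^ n * ‖F y‖ * ((3 / 2 : ℝ) ^ (6 * n) * t ^ (6 * n)) := by gcongr
    _ ≤ M ^ n * ‖F y‖ * ((3 / 2 : ℝ) ^ (6 * n) * t ^ (6 * n)) * ((12 * a) ^ (E * n) * t ^ (E * n)) :=
        le_mul_of_one_le_right (by positivity) h2t
    _ = M ^ n * (3 / 2 : ℝ) ^ (6 * n) * (12 * a) ^ (E * n) * (t ^ ((6 + E) * n) * ‖F y‖) := by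
        rw [hsplit]; ring
    _ ≤ M ^ n * (3 / 2 : ℝ) ^ (6 * n) * (12 * a) ^ (E * n) * S := by gcongr
    _ = M ^ n * (3 / 2) ^ (6 * n) * 12 ^ (E * n) * a ^ (E * n) * S := by rw [mul_pow 12 a]; ring

/-- **Near-diagonal zone** (a pair at lattice sup-distance `≤ 5`, so `‖yᵢ − yⱼ‖ ≤ 22a`): flat decay of order `En`. -/
theorem ssb_near (F : 𝓢((Fin n → (EuclideanSpace ℝ (Fin 4))), ℂ)) (hF : IsOffDiagonal F) {a : ℝ} (ha : 0 < a)
    (x : Fin n → Site 4) {i j : Fin n} (hij : i ≠ j) (hclose : ‖x i - x j‖ ≤ 5)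
    (y : Fin n → (EuclideanSpace ℝ (Fin 4))) (hyx : ∀ l, ‖y l - a • siteToE (x l)‖ ≤ 6 * a) {W M : ℝ} (hM : 0 ≤ M)
    (hW : |W| ≤ M ^ n) (E : ℕ) :
    |W| * ‖F y‖ * (1 + ‖y‖) ^ (6 * n) ≤
      M ^ n * 2 ^ (6 * n) * 22 ^ (E * n) * a ^ (E * n) *
        (SchwartzMap.seminorm ℂ 0 (E * n) F + SchwartzMap.seminorm ℂ (6 * n) (E * n) F) := by
  have hsep : ‖y i - y j‖ ≤ 22 * a := by
    have := norm_sub_le_of_shift ha.le hyx i j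
    nlinarith
  have hflat0 := offDiagonal_pow_mul_norm_le F hF 0 (E * n) hij y
  have hflat6 := offDiagonal_pow_mul_norm_le F hF (6 * n) (E * n) hij y
  rw [pow_zero, one_mul] at hflat0
  have hpw : ‖y i - y j‖ ^ (E * n) ≤ (22 * a) ^ (E * n) := pow_le_pow_left₀ (norm_nonneg _) hsep _
  have hA : ‖F y‖ ≤ SchwartzMap.seminorm ℂ 0 (E * n) F * (22 * a) ^ (E * n) :=
    hflat0.trans (mul_le_mul_of_nonneg_left hpw (apply_nonneg _ _))
  have hB : ‖y‖ ^ (6 * n) * ‖F y‖ ≤ SchwartzMap.seminorm ℂ (6 * n) (E * n) F * (22 * a) ^ (E * n) :=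
    hflat6.trans (mul_le_mul_of_nonneg_left hpw (apply_nonneg _ _))
  have hcomb := norm_mul_one_add_pow_le hA hB
  have hWn : 0 ≤ |W| := abs_nonneg _
  calc |W| * ‖F y‖ * (1 + ‖y‖) ^ (6 * n) = |W| * (‖F y‖ * (1 + ‖y‖) ^ (6 * n)) := by ring
    _ ≤ M ^ n * (2 ^ (6 * n) * (SchwartzMap.seminorm ℂ 0 (E * n) F * (22 * a) ^ (E * n) +
          SchwartzMap.seminorm ℂ (6 * n) (E * n) F * (22 * a) ^ (E * n))) := by gcongr
    _ = M ^ n * 2 ^ (6 * n) * 22 ^ (E * n) * a ^ (E * n) *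
        (SchwartzMap.seminorm ℂ 0 (E * n) F + SchwartzMap.seminorm ℂ (6 * n) (E * n) F) := by
        rw [mul_pow 22 a]; ring

/-- **Separated zone, inner multi-sites** (all `3‖xᵢ‖ ≤ L`, all pairs `> 5` apart): with `ρ ≥ 6` the closest lattice
distance, `R = min R₀ ⌊(ρ−2)/2⌋₊` meets the separated bound (`1 ≤ R ≤ R₀`, `2R+1 < ρ ≤ |Δ_μ| ≤ L`); either `R = R₀`
(plain decay) or `R₀/R ≤ 6δ/(aρ)` and flat decay of order `Pn` gives `(24δ)^{Pn}`. -/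
theorem ssb_far (F : 𝓢((Fin n → (EuclideanSpace ℝ (Fin 4))), ℂ)) (hF : IsOffDiagonal F) {a : ℝ} (ha : 0 < a) {L R₀ : ℕ}
    (hR₀ : 1 ≤ R₀) {D : ℝ} (hD : 0 < D) (hRa : (R₀ : ℝ) * a ≤ D) {B : ℝ} (hB : 0 ≤ B) {P : ℕ}
    (W : (Fin n → Site 4) → ℝ) (x : Fin n → Site 4)
    (hsepW : ∀ R : ℕ, 1 ≤ R → R ≤ R₀ →
      (∀ k l : Fin n, k ≠ l → ∃ μ : Fin 4, (2 * R + 1 : ℤ) < |x k μ - x l μ| ∧ |x k μ - x l μ| ≤ L) →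
        |W x| ≤ (B * ((R₀ : ℝ) / R) ^ P) ^ n)
    (hn : 2 ≤ n) (hinner : ∀ i, 3 * ‖x i‖ ≤ (L : ℝ)) (hfar : ∀ i j : Fin n, i ≠ j → 5 < ‖x i - x j‖)
    (y : Fin n → (EuclideanSpace ℝ (Fin 4))) (hyx : ∀ l, ‖y l - a • siteToE (x l)‖ ≤ 6 * a) :
    |W x| * ‖F y‖ * (1 + ‖y‖) ^ (6 * n) ≤
      B ^ n * 2 ^ (6 * n) * ((24 * D) ^ (P * n) + 1) *
        (SchwartzMap.seminorm ℂ 0 0 F + SchwartzMap.seminorm ℂ (6 * n) 0 F +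
          SchwartzMap.seminorm ℂ 0 (P * n) F + SchwartzMap.seminorm ℂ (6 * n) (P * n) F) := by
  classical
  -- the closest pair and its lattice distance `ρ ≥ 6`
  have hpairs : (Finset.univ.filter fun p : Fin n × Fin n => p.1 ≠ p.2).Nonempty := by
    refine ⟨(⟨0, by omega⟩, ⟨1, by omega⟩), ?_⟩
    simp [Fin.ext_iff]
  obtain ⟨⟨i₀, j₀⟩, hmem, hmin⟩ :=
    Finset.exists_min_image _ (fun p : Fin n × Fin n => ‖x p.1 - x p.2‖) hpairs
  simp only [Finset.mem_filter, Finset.mem_univ, true_and] at hmem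
  set ρ : ℝ := ‖x i₀ - x j₀‖ with hρ
  have hρ5 : 5 < ρ := hfar i₀ j₀ hmem
  have hρmin : ∀ i j : Fin n, i ≠ j → ρ ≤ ‖x i - x j‖ := fun i j hij => hmin (i, j) (by simp [hij])
  have hρ6 : 6 ≤ ρ := by
    obtain ⟨k₀, hk₀⟩ := exists_norm_eq_abs_coord (x i₀ - x j₀)
    have h1 : ρ = ((|(x i₀ - x j₀) k₀| : ℤ) : ℝ) := by rw [hρ, hk₀, Int.cast_abs]
    have h2 : (5 : ℝ) < ((|(x i₀ - x j₀) k₀| : ℤ) : ℝ) := h1 ▸ hρ5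
    have h3 : (5 : ℤ) < |(x i₀ - x j₀) k₀| := by exact_mod_cast h2
    have h4 : (6 : ℤ) ≤ |(x i₀ - x j₀) k₀| := h3
    rw [h1]; exact_mod_cast h4
  -- the radius
  set R : ℕ := min R₀ ⌊(ρ - 2) / 2⌋₊ with hRdef
  have hfloor1 : 1 ≤ ⌊(ρ - 2) / 2⌋₊ := Nat.le_floor (by push_cast; linarith)
  have hR1 : 1 ≤ R := le_min hR₀ hfloor1
  have hRR₀ : R ≤ R₀ := min_le_left _ _
  have hRle : (R : ℝ) ≤ (ρ - 2) / 2 := by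
    have h1 : ((min R₀ ⌊(ρ - 2) / 2⌋₊ : ℕ) : ℝ) ≤ (⌊(ρ - 2) / 2⌋₊ : ℝ) := by exact_mod_cast min_le_right _ _
    exact h1.trans (Nat.floor_le (by linarith))
  -- the separation hypothesis of the separated bound holds at `R`
  have hsep : ∀ k l : Fin n, k ≠ l → ∃ μ : Fin 4, (2 * R + 1 : ℤ) < |x k μ - x l μ| ∧ |x k μ - x l μ| ≤ L := by
    intro k l hkl
    obtain ⟨μ, hμ⟩ := exists_norm_eq_abs_coord (x k - x l)
    refine ⟨μ, ?_, ?_⟩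
    · have h1 : (2 * (R : ℝ) + 1) < ‖x k - x l‖ := by linarith [hρmin k l hkl]
      rw [hμ, Pi.sub_apply, ← Int.cast_abs] at h1
      exact_mod_cast h1
    · have h1 : ‖x k - x l‖ ≤ (L : ℝ) := by
        have h2 : ‖x k - x l‖ ≤ ‖x k‖ + ‖x l‖ := norm_sub_le _ _
        linarith [hinner k, hinner l, norm_nonneg (x k), norm_nonneg (x l)]
      rw [hμ, Pi.sub_apply, ← Int.cast_abs] at h1
      exact_mod_cast h1
  have hWx := hsepW R hR1 hRR₀ hsep
  -- the seminorms
  set S00 := SchwartzMap.seminorm ℂ 0 0 F with hS00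
  set S60 := SchwartzMap.seminorm ℂ (6 * n) 0 F with hS60
  set S0P := SchwartzMap.seminorm ℂ 0 (P * n) F with hS0P
  set S6P := SchwartzMap.seminorm ℂ (6 * n) (P * n) F with hS6P
  have hS00' : 0 ≤ S00 := apply_nonneg _ _
  have hS60' : 0 ≤ S60 := apply_nonneg _ _
  have hS0P' : 0 ≤ S0P := apply_nonneg _ _
  have hS6P' : 0 ≤ S6P := apply_nonneg _ _
  have hpos1 : 0 ≤ ‖F y‖ * (1 + ‖y‖) ^ (6 * n) := by positivity
  have hRpos : (0 : ℝ) < R := by exact_mod_cast hR1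
  have hR₀pos : (0 : ℝ) < R₀ := by exact_mod_cast hR₀
  have hratio0 : 0 ≤ (R₀ : ℝ) / R := by positivity
  -- plain decay (used in both cases for the shape of the right-hand side)
  have hA0 : ‖F y‖ ≤ S00 := by
    have := pow_mul_norm_le_seminorm F 0 y; rwa [pow_zero, one_mul] at this
  have hB0 : ‖y‖ ^ (6 * n) * ‖F y‖ ≤ S60 := pow_mul_norm_le_seminorm F (6 * n) y
  have hplain := norm_mul_one_add_pow_le hA0 hB0
  by_cases hcase : R₀ ≤ ⌊(ρ - 2) / 2⌋₊
  · -- `R = R₀`: the separated bound is `Bⁿ`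
    have hRR : R = R₀ := min_eq_left hcase
    have hW1 : |W x| ≤ B ^ n := by
      have : ((R₀ : ℝ) / R) = 1 := by rw [hRR]; exact div_self hR₀pos.ne'
      simpa [this] using hWx
    calc |W x| * ‖F y‖ * (1 + ‖y‖) ^ (6 * n) = |W x| * (‖F y‖ * (1 + ‖y‖) ^ (6 * n)) := by ring
      _ ≤ B ^ n * (2 ^ (6 * n) * (S00 + S60)) := by gcongr
      _ = B ^ n * 2 ^ (6 * n) * 1 * (S00 + S60) := by ring
      _ ≤ B ^ n * 2 ^ (6 * n) * ((24 * D) ^ (P * n) + 1) * (S00 + S60 + S0P + S6P) := by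
          have h1 : (1 : ℝ) ≤ (24 * D) ^ (P * n) + 1 := by
            linarith [pow_nonneg (by positivity : (0 : ℝ) ≤ 24 * D) (P * n)]
          have h2 : S00 + S60 ≤ S00 + S60 + S0P + S6P := by linarith
          have h0 : 0 ≤ B ^ n * 2 ^ (6 * n) := by positivity
          calc B ^ n * 2 ^ (6 * n) * 1 * (S00 + S60) = (B ^ n * 2 ^ (6 * n)) * (1 * (S00 + S60)) := by ring
            _ ≤ (B ^ n * 2 ^ (6 * n)) * (((24 * D) ^ (P * n) + 1) * (S00 + S60 + S0P + S6P)) :=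
                mul_le_mul_of_nonneg_left (mul_le_mul h1 h2 (by positivity) (by positivity)) h0
            _ = _ := by ring
  · -- `R = ⌊(ρ−2)/2⌋₊ ≥ ρ/6`, so `R₀/R ≤ 6D/(aρ)`; flat decay of order `Pn`
    have hRR : R = ⌊(ρ - 2) / 2⌋₊ := min_eq_right (le_of_lt (not_le.1 hcase))
    have hRge : ρ / 6 ≤ (R : ℝ) := by
      have h1 : (ρ - 2) / 2 < (⌊(ρ - 2) / 2⌋₊ : ℝ) + 1 := Nat.lt_floor_add_one _
      rw [hRR]; linarith
    have hρpos : 0 < ρ := by linarith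
    have hratio : (R₀ : ℝ) / R ≤ 6 * D / (a * ρ) := by
      have h1 : (R₀ : ℝ) ≤ D / a := by rw [le_div_iff₀ ha]; exact hRa
      have h2 : 6 * D / (a * ρ) = (D / a) / (ρ / 6) := by field_simp
      rw [h2]
      exact div_le_div₀ (by positivity) h1 (by positivity) hRge
    have hWle : |W x| ≤ B ^ n * (6 * D / (a * ρ)) ^ (P * n) := by
      refine hWx.trans ?_
      rw [mul_pow, ← pow_mul]
      gcongr
    -- flat decay against the closest pair: `‖y i₀ − y j₀‖ ≤ 4aρ`
    have hsepy : ‖y i₀ - y j₀‖ ≤ 4 * a * ρ := by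
      have h1 := norm_sub_le_of_shift ha.le hyx i₀ j₀
      rw [← hρ] at h1
      nlinarith
    have hflat0 := offDiagonal_pow_mul_norm_le F hF 0 (P * n) hmem y
    have hflat6 := offDiagonal_pow_mul_norm_le F hF (6 * n) (P * n) hmem y
    rw [pow_zero, one_mul] at hflat0
    have hpw : ‖y i₀ - y j₀‖ ^ (P * n) ≤ (4 * a * ρ) ^ (P * n) := pow_le_pow_left₀ (norm_nonneg _) hsepy _
    have hκ : (6 * D / (a * ρ)) ^ (P * n) * (4 * a * ρ) ^ (P * n) = (24 * D) ^ (P * n) := by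
      rw [← mul_pow]; congr 1; field_simp; ring
    have hκ0 : (0 : ℝ) ≤ (6 * D / (a * ρ)) ^ (P * n) := by positivity
    have hA : ‖(((6 * D / (a * ρ)) ^ (P * n) : ℝ) : ℂ) • F y‖ ≤ S0P * (24 * D) ^ (P * n) := by
      rw [norm_smul, Complex.norm_real, Real.norm_of_nonneg hκ0]
      calc (6 * D / (a * ρ)) ^ (P * n) * ‖F y‖
          ≤ (6 * D / (a * ρ)) ^ (P * n) * (S0P * (4 * a * ρ) ^ (P * n)) := by
            gcongr; exact hflat0.trans (mul_le_mul_of_nonneg_left hpw (apply_nonneg _ _))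
        _ = S0P * ((6 * D / (a * ρ)) ^ (P * n) * (4 * a * ρ) ^ (P * n)) := by ring
        _ = _ := by rw [hκ]
    have hB' : ‖y‖ ^ (6 * n) * ‖(((6 * D / (a * ρ)) ^ (P * n) : ℝ) : ℂ) • F y‖ ≤ S6P * (24 * D) ^ (P * n) := by
      rw [norm_smul, Complex.norm_real, Real.norm_of_nonneg hκ0]
      calc ‖y‖ ^ (6 * n) * ((6 * D / (a * ρ)) ^ (P * n) * ‖F y‖)
          = (6 * D / (a * ρ)) ^ (P * n) * (‖y‖ ^ (6 * n) * ‖F y‖) := by ring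
        _ ≤ (6 * D / (a * ρ)) ^ (P * n) * (S6P * (4 * a * ρ) ^ (P * n)) :=
            mul_le_mul_of_nonneg_left (hflat6.trans (mul_le_mul_of_nonneg_left hpw (apply_nonneg _ _))) hκ0
        _ = S6P * ((6 * D / (a * ρ)) ^ (P * n) * (4 * a * ρ) ^ (P * n)) := by ring
        _ = _ := by rw [hκ]
    have hcomb := norm_mul_one_add_pow_le hA hB'
    rw [norm_smul, Complex.norm_real, Real.norm_of_nonneg hκ0] at hcomb
    calc |W x| * ‖F y‖ * (1 + ‖y‖) ^ (6 * n) = |W x| * (‖F y‖ * (1 + ‖y‖) ^ (6 * n)) := by ring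
      _ ≤ B ^ n * (6 * D / (a * ρ)) ^ (P * n) * (‖F y‖ * (1 + ‖y‖) ^ (6 * n)) :=
          mul_le_mul_of_nonneg_right hWle hpos1
      _ = B ^ n * ((6 * D / (a * ρ)) ^ (P * n) * ‖F y‖ * (1 + ‖y‖) ^ (6 * n)) := by ring
      _ ≤ B ^ n * (2 ^ (6 * n) * (S0P * (24 * D) ^ (P * n) + S6P * (24 * D) ^ (P * n))) := by gcongr
      _ = B ^ n * 2 ^ (6 * n) * (24 * D) ^ (P * n) * (S0P + S6P) := by ring
      _ ≤ B ^ n * 2 ^ (6 * n) * ((24 * D) ^ (P * n) + 1) * (S00 + S60 + S0P + S6P) := by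
          have h1 : (24 * D) ^ (P * n) ≤ (24 * D) ^ (P * n) + 1 := by linarith
          have h2 : S0P + S6P ≤ S00 + S60 + S0P + S6P := by linarith
          have h0 : 0 ≤ B ^ n * 2 ^ (6 * n) := by positivity
          calc B ^ n * 2 ^ (6 * n) * (24 * D) ^ (P * n) * (S0P + S6P)
              = (B ^ n * 2 ^ (6 * n)) * ((24 * D) ^ (P * n) * (S0P + S6P)) := by ring
            _ ≤ (B ^ n * 2 ^ (6 * n)) * (((24 * D) ^ (P * n) + 1) * (S00 + S60 + S0P + S6P)) :=
                mul_le_mul_of_nonneg_left (mul_le_mul h1 h2 (by positivity) (by positivity)) h0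
            _ = _ := by ring

/-! ### All zones, and the summable lattice weight -/

/-- **Per-point bound, all zones** (constants `c₁ = (24δ)^{Pn} + 1`, `c₂ = (3/2)^{6n} 12^{En} + 22^{En}`). -/
theorem ssb_pointwise :
    ∀ {n : ℕ} (F : 𝓢((Fin n → EuclideanSpace ℝ (Fin 4)), ℂ)), IsOffDiagonal F → ∀ {a : ℝ}, 0 < a → a ≤ 1 / 24 →
      ∀ {L R₀ : ℕ}, a⁻¹ * a⁻¹ ≤ (L : ℝ) → 1 ≤ R₀ → ∀ {D : ℝ}, 0 < D → (R₀ : ℝ) * a ≤ D →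
      ∀ {M B : ℝ}, 0 ≤ M → 0 ≤ B → ∀ {P E : ℕ} (W : (Fin n → Site 4) → ℝ), (∀ x, |W x| ≤ M ^ n) →
      ∀ (x : Fin n → Site 4), (∀ R : ℕ, 1 ≤ R → R ≤ R₀ →
        (∀ k l : Fin n, k ≠ l → ∃ μ : Fin 4, (2 * R + 1 : ℤ) < |x k μ - x l μ| ∧ |x k μ - x l μ| ≤ L) →
          |W x| ≤ (B * ((R₀ : ℝ) / R) ^ P) ^ n) →
      2 ≤ n → ∀ (y : Fin n → EuclideanSpace ℝ (Fin 4)), (∀ l, ‖y l - a • siteToE (x l)‖ ≤ 6 * a) →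
    |W x| * ‖F y‖ * (1 + ‖y‖) ^ (6 * n) ≤
      2 ^ (6 * n) * (B ^ n * ((24 * D) ^ (P * n) + 1) +
          M ^ n * a ^ (E * n) * ((3 / 2) ^ (6 * n) * 12 ^ (E * n) + 22 ^ (E * n))) *
        (SchwartzMap.seminorm ℂ 0 0 F + SchwartzMap.seminorm ℂ (6 * n) 0 F +
          SchwartzMap.seminorm ℂ 0 (P * n) F + SchwartzMap.seminorm ℂ (6 * n) (P * n) F +
          SchwartzMap.seminorm ℂ ((6 + E) * n) 0 F +
          SchwartzMap.seminorm ℂ 0 (E * n) F + SchwartzMap.seminorm ℂ (6 * n) (E * n) F) := by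
  intro n F hF a ha ha24 L R₀ hL hR₀ D hD hRa M B hM hB P E W hWsup x hsepW hn y hyx
  classical
  set S00 := SchwartzMap.seminorm ℂ 0 0 F
  set S60 := SchwartzMap.seminorm ℂ (6 * n) 0 F
  set S0P := SchwartzMap.seminorm ℂ 0 (P * n) F
  set S6P := SchwartzMap.seminorm ℂ (6 * n) (P * n) F
  set SE0 := SchwartzMap.seminorm ℂ ((6 + E) * n) 0 F
  set S0E := SchwartzMap.seminorm ℂ 0 (E * n) F
  set S6E := SchwartzMap.seminorm ℂ (6 * n) (E * n) F
  have hS00 : 0 ≤ S00 := apply_nonneg _ _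
  have hS60 : 0 ≤ S60 := apply_nonneg _ _
  have hS0P : 0 ≤ S0P := apply_nonneg _ _
  have hS6P : 0 ≤ S6P := apply_nonneg _ _
  have hSE0 : 0 ≤ SE0 := apply_nonneg _ _
  have hS0E : 0 ≤ S0E := apply_nonneg _ _
  have hS6E : 0 ≤ S6E := apply_nonneg _ _
  set c₁ : ℝ := (24 * D) ^ (P * n) + 1 with hc₁
  set c₂ : ℝ := (3 / 2) ^ (6 * n) * 12 ^ (E * n) + 22 ^ (E * n) with hc₂
  have hc₁0 : 0 ≤ c₁ := by positivity
  have hc₂0 : 0 ≤ c₂ := by positivity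
  set S7 := S00 + S60 + S0P + S6P + SE0 + S0E + S6E with hS7
  have hS70 : 0 ≤ S7 := by positivity
  have hBn : 0 ≤ B ^ n * c₁ := by positivity
  have hMn : 0 ≤ M ^ n * a ^ (E * n) * c₂ := by positivity
  have h26 : (0 : ℝ) ≤ 2 ^ (6 * n) := by positivity
  by_cases houter : ∃ i, (L : ℝ) < 3 * ‖x i‖
  · obtain ⟨i, hi⟩ := houter
    calc _ ≤ M ^ n * (3 / 2) ^ (6 * n) * 12 ^ (E * n) * a ^ (E * n) * SE0 :=
          ssb_outer F ha ha24 hL x hi y hyx hM (hWsup x) E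
      _ ≤ M ^ n * (3 / 2) ^ (6 * n) * 12 ^ (E * n) * a ^ (E * n) * S7 := by
          gcongr; rw [hS7]; linarith
      _ ≤ 2 ^ (6 * n) * (M ^ n * a ^ (E * n) * c₂) * S7 := by
          refine mul_le_mul_of_nonneg_right ?_ hS70
          have h1 : (1 : ℝ) ≤ 2 ^ (6 * n) := one_le_pow₀ (by norm_num)
          have h2 : (3 / 2 : ℝ) ^ (6 * n) * 12 ^ (E * n) ≤ c₂ := by
            rw [hc₂]; linarith [pow_nonneg (by norm_num : (0 : ℝ) ≤ 22) (E * n)]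
          calc M ^ n * (3 / 2) ^ (6 * n) * 12 ^ (E * n) * a ^ (E * n)
              = 1 * (M ^ n * a ^ (E * n) * ((3 / 2) ^ (6 * n) * 12 ^ (E * n))) := by ring
            _ ≤ 2 ^ (6 * n) * (M ^ n * a ^ (E * n) * c₂) := by gcongr
      _ ≤ 2 ^ (6 * n) * (B ^ n * c₁ + M ^ n * a ^ (E * n) * c₂) * S7 := by
          gcongr; linarith
  · push Not at houter
    by_cases hnear : ∃ i j : Fin n, i ≠ j ∧ ‖x i - x j‖ ≤ 5
    · obtain ⟨i, j, hij, hclose⟩ := hnear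
      calc _ ≤ M ^ n * 2 ^ (6 * n) * 22 ^ (E * n) * a ^ (E * n) * (S0E + S6E) :=
            ssb_near F hF ha x hij hclose y hyx hM (hWsup x) E
        _ ≤ M ^ n * 2 ^ (6 * n) * 22 ^ (E * n) * a ^ (E * n) * S7 := by
            gcongr; rw [hS7]; linarith
        _ ≤ 2 ^ (6 * n) * (M ^ n * a ^ (E * n) * c₂) * S7 := by
            refine mul_le_mul_of_nonneg_right ?_ hS70
            have h2 : (22 : ℝ) ^ (E * n) ≤ c₂ := by
              rw [hc₂]; linarith [mul_nonneg (pow_nonneg (by norm_num : (0 : ℝ) ≤ 3 / 2) (6 * n))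
                (pow_nonneg (by norm_num : (0 : ℝ) ≤ 12) (E * n))]
            calc M ^ n * 2 ^ (6 * n) * 22 ^ (E * n) * a ^ (E * n)
                = 2 ^ (6 * n) * (M ^ n * a ^ (E * n) * 22 ^ (E * n)) := by ring
              _ ≤ 2 ^ (6 * n) * (M ^ n * a ^ (E * n) * c₂) := by gcongr
        _ ≤ 2 ^ (6 * n) * (B ^ n * c₁ + M ^ n * a ^ (E * n) * c₂) * S7 := by
            gcongr; linarith
    · push Not at hnear
      have hfar : ∀ i j : Fin n, i ≠ j → 5 < ‖x i - x j‖ := fun i j hij => hnear i j hij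
      calc _ ≤ B ^ n * 2 ^ (6 * n) * c₁ * (S00 + S60 + S0P + S6P) :=
            ssb_far F hF ha hR₀ hD hRa hB W x hsepW hn houter hfar y hyx
        _ ≤ B ^ n * 2 ^ (6 * n) * c₁ * S7 := by
            gcongr; rw [hS7]; linarith
        _ = 2 ^ (6 * n) * (B ^ n * c₁) * S7 := by ring
        _ ≤ 2 ^ (6 * n) * (B ^ n * c₁ + M ^ n * a ^ (E * n) * c₂) * S7 := by
            gcongr; linarith

end Summit.QuantumFields.YangMills.Cruxes.HypercubicLimit.ConditionalMeanTelescoping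

end
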